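import Summits.QuantumFields.YangMills.Theorems.BalabanUVNodesN16SlotKeyQuarter
import HarnessLib

/-!
# Route «BalabanUVNodes» (K3⁷ `SpineGivenEndpointR13SepCoPH`, stmt-QuantumFields-20544), DAG node N16 = NE3, in-edge N07 → N16 — THE UNIT THRESHOLD OF THE SLOT KEY's
# (8)-RADIUS CONSTANT `B₃`: with [Balaban1985Averaging] Prop. 2 in its SHARP form (leading constant ONE) every threshold of file 13 moves from `1∕4` to `B₃ = 1`, i.e. to
# PRINT's OWN REMARK p. 278 «our assumption has a meaning only for ε₁ smaller than ε₀» (`ε₀ = B₃ε₁`) read at the slot key: (T8) ⟹ `1 ≤ B₃`, (T9ˢ) below `B₃ = 1` is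
# the full-window `stub_h7` leaf, and the `∃ C` of `stub_reg910Slot` ranges WITHOUT LOSS over `B₃ ≥ 1`

Cell `pub-ymgap`, width seat `pub-ymgap-dag-n16-w1` (director-ym №197 ∕ HUMAN RULING D-0149), generation 6, file 14 of this lineage — the sharpening of file 13
(`…N16SlotKeyQuarter` p618486, whose `1∕4` carried the slack factor `4` of file 4 §1 `datum_mem_sfClass_of_isMinimiser`).  `--kind proof --supports stmt-QuantumFields-20544
--as helper` (count-neutral).  `bears_on: R4∕N16 · edge N07 → N16`.  THEOREMS ONLY (0 `def`, 0 `sorry`, standard axioms); BY NAME over leaf-05's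
`Support/MinimalActionCompact.avgIter_unitary_smallField` (cell `pub-balaban`: the `k`-fold (43)-average of a unitary configuration with plaquettes `≤ r·(L^k)^{−2}` has
plaquettes `≤ r + (16∕3)C₀(d)r²` — Prop. 2 (54) with leading constant one), file 4's `isPeriodicCfg_avgIter`, file 9's `leafH3sup_loose_of_reg910Slot`, file 13's
`reg910Slot_mono_B₃`, dag-n16-w2's `exists_constDatum`, dag-n16-w5's `exists_twisted_datum`.

THE POINT.  The SLOT KEY at constants `C` (file 9 §1; = `stub_reg910Slot` of the DischargeTests v6 ∕ v6L with `∃ G C`) has the (8)-class radius `B₃ε₁` and the (7)-datum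
radius `ε₁`.  [Balaban1985Variational] p. 278 remarks that the pair «(6) non-empty, (7)» only has content for `ε₁ < ε₀`; at the slot key `ε₀ = B₃ε₁`, so the remark says
`B₃ ≥ 1` up to Prop. 2's second-order term.  In the kernel:
* §1 `datum_mem_sfClass_sharp_of_mem_admissible` ∕ `…_of_isMinimiser`: the datum of an `r`-class admissible configuration (a fortiori of an (8)-class minimiser) of run
  `k+1` lies in `sfClass d L N (r + (16∕3)C₀r²) 0` (unitary, `N`-periodic, SHARP small-field radius), `16C₀r ≤ 3`, `1024(d+1)(d+4)L²r ≤ 1`, `L ≥ 2`.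
* §2 **(T8) ⟹ `1 ≤ B₃`.**  `le_B₃_of_exists8Min_of_witness`: a datum of `sfClass d L N ε₁ 0` with a plaquette `≥ qε₁` for all small `ε₁` forces
  `q ≤ B₃ + (16∕3)C₀B₃²ε₁` for every small `ε₁ > 0`, hence `q ≤ B₃`; the constant `SU(2)` datum (`q = 1`) gives `one_le_B₃_of_exists8Min_rank_two` (rank two, `d ≥ 2`,
  `L ≥ 2`, any `N`) and `not_exists8Min_rank_two_of_B₃_lt_one`; the twisted datum (`q = 1∕8`) gives `eighth_le_B₃_of_exists8Min` (every rank, `N ≥ 2`).  §2b: this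
  lineage's displayed `Thm1AtTransfer04toSlot F 2 ζ B` (file 10) at ANY `B < 1` has an uninhabitable consequent, is `¬`(node N07's K1-side Theorem-1 sentence), and its pair
  with `B11Leaf (Z11OfRecord F 2 ζ)` is uninhabited (A6 species on my own def; consumers of record key `B ≥ 2^78·L^12`, unaffected).
* §3 **(T9ˢ) at `B₃ < 1` ⟹ THE `stub_h7` LEAF ON ALL DATA** for `0 < ε ≤ ε₀(C)`: whenever `B₃(ε + (16∕3)C₀ε²) ≤ ε` the loose cut `V ∈ sfClass (ε∕B₃) 0` of file 9 §2 is
  automatic for every datum carrying an `ε`-minimiser (§1), so the leaf `LeafH3sup d L N ε ε (16937ε)` holds on EVERY `dom` (`leafH3sup_all_of_reg910Slot_of_window`), in the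
  `∃ C′ ε₀` shape for `B₃ < 1` (`h7Shape_of_reg910Slot_of_B₃_lt_one`, `ε₀ = min(B₃a₁, 1∕28, 3∕(16C₀), 1∕(1024(d+1)(d+4)L²), 3(1−B₃)∕(16C₀B₃))`) and at the record with
  dag-n16-e's `stub_h7 F` TEXT as conclusion (`h7_at_record_of_reg910Slot_of_B₃_lt_one`) — tight window AP-N16-2 included (model-false by FRONTS, file 5 + evidence #27∕#28).
* §4 **`(∃ C, key) ⟺ (∃ C, 1 ≤ C.B₃ ∧ key)`** (`exists_consts_iff_one_le`, file 13's antitonicity `reg910Slot_mono_B₃` at the block `C′ = (a₀, B₃a₁, 1, B₄, M(·))`; the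
  DischargeTests' `∃ G C` stub shape: `exists_shape_one_le_of_exists_shape`): the `∃ C` of `stub_reg910Slot` ranges WITHOUT LOSS over `B₃ ≥ 1` — the (8)-class radius
  dominates the (7)-radius, exactly as print assumes; for a disprover, `B₃ < 1` is the model-false tight window again.
COMPLEMENT (dag-n16-w2 g5, `…N16SlotKeyFlatModuli` p620000 §1): at any FIXED run (8) holds with the k-DEPENDENT constant `B₃(k) = L^{2(k+1)}` (pull-back section of the
(42)-average) — so the content of (T8) is the k-UNIFORM constant, bounded below by `1` here and free to grow like `L^{2k}` there.
MODEL-LEVEL REMARK (evidence #27∕#28 of this lineage, NOT kernel): in the linearised alternating-data (42)-model the FRONT regime sits at relative datum size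
`s ∈ (1∕2 − δ, 1∕2)` of the class radius with `δ < 4∕(3M²) ≈ 0.18` at the slot constant `M ≤ 11∕4`, i.e. inside the key's window iff `1∕B₃ ≳ 0.32`: the model threshold is
`B₃ ≈ 3`, this file's kernel threshold `B₃ = 1`; print's `B₃ ≥ 72d³L³B₀` ([Balaban1985Variational] (162)) is far above both.

HONEST FRAMING.  Kernel bookkeeping over landed theorems BY NAME plus one limit `ε₁ → 0`; the slot key stays a DISPLAYED hypothesis (node N07's content =
[Balaban1985Variational] Thm 1 (8)–(10) at the (42)-objects + the (0.4)→(42) transfer + located A1 ∕ D-s3-2), NOT asserted and NOT refuted at or above `B₃ = 1`; `stub_h7` NOT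
closed; no stub of K3⁷ v5 named or closed; N16 ∕ N07 ∕ N19 NOT discharged; count-neutral; counts of record unmoved (typed 28∕28 · discharged 5∕28); one finite four-torus at
fixed `ε`, Bałaban AS PRINTED — NOT ℝ⁴, NOT infinite volume, NOT OS, NOT a mass gap; the YM mass gap (Clay) is NOT proved by any of this — R4 closes the conditional
finite-𝕋⁴ rung `BalabanLadder.UV` only.
-/

set_option autoImplicit false

open scoped BigOperators Matrix Matrix.Norms.L2Operator
open NormedSpace

namespace Summit.QuantumFields.YangMills.BalabanUVNodes.N16SlotKeyUnit

open Literature.MathematicalPhysics.QuantumFieldTheory.Balaban1983to89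
open B7Prop1Explicit B7Prop2Explicit MatrixLog UnitaryModel
open T4AveragingDeficitWall hiding Site Plane Plaq Bond
open T4AveragingDeficitWallBoundary (IsPeriodicCfg)
open T4Continuum (T4Family)
open Summit.QuantumFields.BalabanUV.T4Continuum
open AveragingDeficitLatticeH2Prep (fd)
open MinimalActionSandwich (IsMinimiser admissible)
open MinimalActionRate (sfClass)
open MinimalActionCompact (avgIter_unitary_smallField)
open MinimalActionDictionary (torusVP RadiiMono cubeM sfClass_mono)
open NE3.LeafIndexSockets (LeafH3sup)
open B11 (Regularity)
open B11Thm1 (Thm1At)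
open B11Thm1CarrierT (varProblemT)
open DagBinding (B11Leaf)
open Node00 (ne3NperOfRecord₁₁ ne3DomOfRecord₁₁ MatA ZIdx ResidZ Z11OfRecord exists_thm1At_of_b11Leaf_Z11OfRecord)
open Summit.QuantumFields.YangMills.BalabanUVNodes.N16H7OfReg9 (leafH3sup_mono)
open Summit.QuantumFields.YangMills.BalabanUVNodes.N16H7NoBinding (isPeriodicCfg_avgIter)
open Summit.QuantumFields.YangMills.BalabanUVNodes.N16H7OfN07RecordSlot (lipGauge)
open Summit.QuantumFields.YangMills.BalabanUVNodes.N16H7LooseOfReg910Slot (leafH3sup_loose_of_reg910Slot)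
open Summit.QuantumFields.YangMills.BalabanUVNodes.N16H7OfN07RecordSlotKey (Thm1AtTransfer04toSlot)
open Summit.QuantumFields.YangMills.BalabanUVNodes.N16Thm1AtTorusVPSmallCubesPrep (exists_constDatum)
open Summit.QuantumFields.YangMills.BalabanUVNodes.N16Thm1AtTorusVPSmallCubesRankN (exists_twisted_datum half_le_norm_exp_I_mul_sub_one)
open Summit.QuantumFields.YangMills.BalabanUVNodes.N16SlotKeyQuarter (reg910Slot_mono_B₃)

noncomputable section

section Generic

variable {d : ℕ} {n : Type} [Fintype n] [DecidableEq n]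

/-! ## §1 The SHARP datum bound: an `r`-class admissible configuration averages into `sfClass (r + (16∕3)C₀r²) 0` -/

/-- **THE DATUM OF AN `r`-CLASS ADMISSIBLE CONFIGURATION IS `(r + (16∕3)C₀r²)`-SMALL** (unitary, `N`-periodic): for `L ≥ 2`, `0 ≤ r`, `16C₀(d)r ≤ 3`,
`1024(d+1)(d+4)L²r ≤ 1`, if `U ∈ sfClass d L N r (k+1)` and `avgIter L U (k+1) = V` then `V ∈ sfClass d L N (r + (16∕3)C₀r²) 0` — leaf-05's sharp transport of
[Balaban1985Averaging] Prop. 2 through the `k+1` averagings (`MinimalActionCompact.avgIter_unitary_smallField` at `j = k+1`, `m = 0`) and file 4's `isPeriodicCfg_avgIter`.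
The leading constant is ONE (file 4 §1's `4r` was slack). [cite: Balaban1985Averaging, Prop. 2 (52)–(54) p.26] -/
theorem datum_mem_sfClass_sharp_of_mem_admissible [Nonempty n] {L N : ℕ} (hL : 2 ≤ L) {r : ℝ} (hr : 0 ≤ r)
    (hr1 : 16 * C0 d * r ≤ 3) (hr2 : 1024 * (d + 1) * (d + 4) * (L : ℝ) ^ 2 * r ≤ 1)
    {k : ℕ} {V U : Site d → Fin d → (Matrix n n ℂ)ˣ} (hU : U ∈ sfClass d L N r (k + 1)) (havg : avgIter L U (k + 1) = V) :
    V ∈ sfClass d L N (r + 16 / 3 * C0 d * r ^ 2) 0 := by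
  obtain ⟨hu, hp, hs⟩ := hU
  obtain ⟨hunit, hsmall⟩ := avgIter_unitary_smallField hL hu hr hr1 hr2 hs (k + 1) 0 rfl
  rw [havg] at hunit hsmall
  refine ⟨hunit, ?_, ?_⟩
  · have hp' : IsPeriodicCfg U ((L : ℤ) ^ (k + 1) * ((N * L ^ 0 : ℕ) : ℤ)) := by
      have h : (L : ℤ) ^ (k + 1) * ((N * L ^ 0 : ℕ) : ℤ) = ((N * L ^ (k + 1) : ℕ) : ℤ) := by push_cast; ring
      rw [h]; exact hp
    have hper := isPeriodicCfg_avgIter L (k + 1) hp'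
    rwa [havg] at hper
  · simpa using hsmall

/-- The same for an (8)-class MINIMISER (its admissibility is all that is used). [cite: Balaban1985Averaging, Prop. 2 (52)–(54) p.26] -/
theorem datum_mem_sfClass_sharp_of_isMinimiser [Nonempty n] {L N : ℕ} (hL : 2 ≤ L) {r : ℝ} (hr : 0 ≤ r)
    (hr1 : 16 * C0 d * r ≤ 3) (hr2 : 1024 * (d + 1) * (d + 4) * (L : ℝ) ^ 2 * r ≤ 1)
    {k : ℕ} {V U : Site d → Fin d → (Matrix n n ℂ)ˣ} (hU : IsMinimiser d (sfClass d L N r) L N (k + 1) V U) :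
    V ∈ sfClass d L N (r + 16 / 3 * C0 d * r ^ 2) 0 :=
  datum_mem_sfClass_sharp_of_mem_admissible hL hr hr1 hr2 hU.mem.1 hU.mem.2

/-! ## §2 (T8) forces `1 ≤ B₃` -/

/-- **(T8) AND A DATUM WITNESS FORCE `q ≤ B₃`** (sharp form of file 13's `q ≤ 4B₃`).  Let `L ≥ 2`.  If (T8) holds at `C` and for all small `ε₁` the class `sfClass d L N ε₁ 0`
contains a datum with a plaquette at distance `≥ q·ε₁` from `1`, then for every `η > 0`, at a radius `ε₁` small enough for Prop. 2's regime AND for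
`(16∕3)C₀B₃²ε₁ ≤ η`, the run-1 minimiser's datum bound (§1) gives `qε₁ ≤ B₃ε₁ + ηε₁`; so `q ≤ B₃ + η` for all `η > 0`, i.e. `q ≤ B₃`. [cite: Balaban1985Averaging, Prop. 2 (52)–(54) p.26] -/
theorem le_B₃_of_exists8Min_of_witness [Nonempty n] {L N : ℕ} (hL : 2 ≤ L) (C : B11Thm1.Consts)
    (hE : ∀ (k : ℕ) (ε₁ : ℝ), 0 < ε₁ → ε₁ ≤ C.a₁ → ∀ V : Site d → Fin d → (Matrix n n ℂ)ˣ, V ∈ sfClass d L N ε₁ 0 →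
      ∃ U : Site d → Fin d → (Matrix n n ℂ)ˣ, IsMinimiser d (sfClass d L N (C.B₃ * ε₁)) L N (k + 1) V U)
    {q w₀ : ℝ} (hw₀ : 0 < w₀)
    (hW : ∀ ε₁ : ℝ, 0 < ε₁ → ε₁ ≤ w₀ → ∃ V : Site d → Fin d → (Matrix n n ℂ)ˣ, V ∈ sfClass d L N ε₁ 0 ∧
      ∃ (x : Site d) (κ κ' : Fin d), κ ≠ κ' ∧ q * ε₁ ≤ ‖((hol V x (plaqWord κ κ') : (Matrix n n ℂ)ˣ) : Matrix n n ℂ) - 1‖) :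
    q ≤ C.B₃ := by
  have hB₃ := C.B₃_pos
  have hC0 := C0_pos d
  have hL0 : (0 : ℝ) < L := by exact_mod_cast (by omega : 0 < L)
  refine le_of_forall_pos_le_add fun η hη => ?_
  -- one radius in every regime at once, and with the second-order term below `η`
  set K : ℝ := 16 / 3 * C0 d * C.B₃ ^ 2 with hKdef
  have hK : 0 < K := by positivity
  set ε₁ : ℝ := min (min C.a₁ w₀) (min (min (3 / (16 * C0 d * C.B₃)) (1 / (1024 * (d + 1) * (d + 4) * (L : ℝ) ^ 2 * C.B₃))) (η / K))
    with hε₁def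
  have hε₁ : 0 < ε₁ :=
    lt_min (lt_min C.a₁_pos hw₀) (lt_min (lt_min (by positivity) (by positivity)) (by positivity))
  have h3 : ε₁ ≤ 3 / (16 * C0 d * C.B₃) := (min_le_right _ _).trans ((min_le_left _ _).trans (min_le_left _ _))
  have h4 : ε₁ ≤ 1 / (1024 * (d + 1) * (d + 4) * (L : ℝ) ^ 2 * C.B₃) :=
    (min_le_right _ _).trans ((min_le_left _ _).trans (min_le_right _ _))
  have h5 : ε₁ ≤ η / K := (min_le_right _ _).trans (min_le_right _ _)
  obtain ⟨V, hV, x, κ, κ', hκ, hq⟩ := hW ε₁ hε₁ ((min_le_left _ _).trans (min_le_right _ _))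
  obtain ⟨U, hU⟩ := hE 0 ε₁ hε₁ ((min_le_left _ _).trans (min_le_left _ _)) V hV
  have hr : 0 ≤ C.B₃ * ε₁ := by positivity
  have hr1 : 16 * C0 d * (C.B₃ * ε₁) ≤ 3 := by
    have h : ε₁ * (16 * C0 d * C.B₃) ≤ 3 := by rwa [le_div_iff₀ (by positivity)] at h3
    nlinarith
  have hr2 : 1024 * (d + 1) * (d + 4) * (L : ℝ) ^ 2 * (C.B₃ * ε₁) ≤ 1 := by
    have h : ε₁ * (1024 * (d + 1) * (d + 4) * (L : ℝ) ^ 2 * C.B₃) ≤ 1 := by rwa [le_div_iff₀ (by positivity)] at h4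
    nlinarith
  obtain ⟨-, -, hs⟩ := datum_mem_sfClass_sharp_of_isMinimiser hL hr hr1 hr2 hU
  have hplaq := hs x κ κ' hκ
  simp only [pow_zero, one_pow, div_one] at hplaq
  -- `q ε₁ ≤ B₃ ε₁ + K ε₁²` and `K ε₁ ≤ η`
  have hKε : K * ε₁ ≤ η := by rwa [le_div_iff₀ hK, mul_comm] at h5
  have hmain : q * ε₁ ≤ (C.B₃ + η) * ε₁ := by
    have h1 : q * ε₁ ≤ C.B₃ * ε₁ + K * ε₁ * ε₁ := by
      have : 16 / 3 * C0 d * (C.B₃ * ε₁) ^ 2 = K * ε₁ * ε₁ := by rw [hKdef]; ring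
      linarith
    nlinarith
  exact le_of_mul_le_mul_right hmain hε₁

/-- **★ (T8) ⟹ `1 ≤ B₃` AT RANK TWO** (`Matrix (Fin 2) (Fin 2) ℂ`; `d ≥ 2`, `L ≥ 2`, any torus factor `N`): the constant `SU(2)` datum of dag-n16-w2
(`exists_constDatum`, in `sfClass d L N ε₁ 0` with a plaquette at distance EXACTLY `ε₁`) is the witness with `q = 1`.  This is [Balaban1985Variational] p. 278's remark at the
slot key: the (8)-radius `ε₀ = B₃ε₁` must dominate the (7)-radius `ε₁`. [cite: Balaban1985Variational, remark after (7) p.278] -/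
theorem one_le_B₃_of_exists8Min_rank_two (hd : 2 ≤ d) {L N : ℕ} (hL : 2 ≤ L) (C : B11Thm1.Consts)
    (hE : ∀ (k : ℕ) (ε₁ : ℝ), 0 < ε₁ → ε₁ ≤ C.a₁ → ∀ V : Site d → Fin d → (Matrix (Fin 2) (Fin 2) ℂ)ˣ, V ∈ sfClass d L N ε₁ 0 →
      ∃ U : Site d → Fin d → (Matrix (Fin 2) (Fin 2) ℂ)ˣ, IsMinimiser d (sfClass d L N (C.B₃ * ε₁)) L N (k + 1) V U) :
    1 ≤ C.B₃ := by
  have h01 : (⟨0, by omega⟩ : Fin d) ≠ ⟨1, by omega⟩ := by simp [Fin.ext_iff]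
  refine le_B₃_of_exists8Min_of_witness hL C hE (q := 1) (w₀ := 2) (by norm_num) (fun ε₁ hε₁ hε₁2 => ?_)
  obtain ⟨V, -, hV, hplaq⟩ := exists_constDatum L N h01 hε₁.le hε₁2
  exact ⟨V, hV, 0, _, _, h01, by rw [one_mul, hplaq]⟩

/-- **(T8) IS FALSE FOR `B₃ < 1` AT RANK TWO** (`d ≥ 2`, `L ≥ 2`, any `N`): the existence half of the slot key cannot hold with an (8)-class narrower than the (7)-class.
Nothing of print is refuted (print's `B₃ ≥ 72d³L³B₀`). [cite: Balaban1985Variational, Thm 1 (8) p.279] -/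
theorem not_exists8Min_rank_two_of_B₃_lt_one (hd : 2 ≤ d) {L N : ℕ} (hL : 2 ≤ L) (C : B11Thm1.Consts) (hB : C.B₃ < 1) :
    ¬ ∀ (k : ℕ) (ε₁ : ℝ), 0 < ε₁ → ε₁ ≤ C.a₁ → ∀ V : Site d → Fin d → (Matrix (Fin 2) (Fin 2) ℂ)ˣ, V ∈ sfClass d L N ε₁ 0 →
      ∃ U : Site d → Fin d → (Matrix (Fin 2) (Fin 2) ℂ)ˣ, IsMinimiser d (sfClass d L N (C.B₃ * ε₁)) L N (k + 1) V U := fun hE =>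
  absurd (one_le_B₃_of_exists8Min_rank_two hd hL C hE) (not_le.2 hB)

/-- **(T8) ⟹ `1∕8 ≤ B₃` IN EVERY RANK** (`Matrix n n ℂ`, `n` non-empty; `d ≥ 2`, `L ≥ 2`, `N ≥ 2`): dag-n16-w5's twisted datum at `θ = ε₁∕4` (in `sfClass d L N ε₁ 0`, a
plaquette at distance `|e^{iθ} − 1| ≥ ε₁∕8`) is the witness with `q = 1∕8` (the slack `4|θ|` of that lemma's class radius costs the factor `8`).
[cite: Balaban1985Variational, Thm 1 (8) p.279] -/
theorem eighth_le_B₃_of_exists8Min [Nonempty n] (hd : 2 ≤ d) {L N : ℕ} (hL : 2 ≤ L) (hN : 2 ≤ N) (C : B11Thm1.Consts)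
    (hE : ∀ (k : ℕ) (ε₁ : ℝ), 0 < ε₁ → ε₁ ≤ C.a₁ → ∀ V : Site d → Fin d → (Matrix n n ℂ)ˣ, V ∈ sfClass d L N ε₁ 0 →
      ∃ U : Site d → Fin d → (Matrix n n ℂ)ˣ, IsMinimiser d (sfClass d L N (C.B₃ * ε₁)) L N (k + 1) V U) :
    1 / 8 ≤ C.B₃ := by
  refine le_B₃_of_exists8Min_of_witness hL C hE (q := 1 / 8) (w₀ := 4) (by norm_num) (fun ε₁ hε₁ hε₁4 => ?_)
  obtain ⟨V, hV, x, κ, κ', hκ, hplaq⟩ := exists_twisted_datum (n := n) hd hN L (ε₁ / 4)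
  have hθ : 4 * |ε₁ / 4| = ε₁ := by rw [abs_of_nonneg (by positivity)]; ring
  rw [hθ] at hV
  refine ⟨V, hV, x, κ, κ', hκ, ?_⟩
  rw [hplaq]
  have h2 := half_le_norm_exp_I_mul_sub_one (θ := ε₁ / 4) (by positivity) (by linarith)
  linarith

end Generic

/-! ### §2b This lineage's displayed transfer `Thm1AtTransfer04toSlot` (file 10) at any radius letter `B < 1` -/

section TransferTwo

/-- **THE CONSEQUENT OF `Thm1AtTransfer04toSlot F 2 ζ B` IS UNINHABITABLE FOR EVERY `B < 1`** (it asks for `C′.B₃ ≤ B` AND (T8) at `C′`; rank two, `d = 4`, `L = F.L ≥ 2`).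
[cite: Balaban1985Variational, Thm 1 (8) p.279] -/
theorem not_consequent_transferSlot_two_of_lt_one (F : T4Family) {B : ℝ} (hB : B < 1) :
    ¬ ∃ C' : B11Thm1.Consts, C'.B₃ ≤ B ∧
      (∀ (k : ℕ) (ε₁ : ℝ), 0 < ε₁ → ε₁ ≤ C'.a₁ → ∀ (V U : Site 4 → Fin 4 → (MatA 2)ˣ), V ∈ sfClass 4 F.L (ne3NperOfRecord₁₁ F 0 0) ε₁ 0 →
        IsMinimiser 4 (sfClass 4 F.L (ne3NperOfRecord₁₁ F 0 0) (C'.B₃ * ε₁)) F.L (ne3NperOfRecord₁₁ F 0 0) (k + 1) V U →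
          ∀ x : Site 4, Regularity (torusVP 4 F.L (ne3NperOfRecord₁₁ F 0 0) (lipGauge 4 (Fin 2)) (k + 1)) C'.B₃ C'.B₄ ε₁ U
            (x, F.L ^ (k + 1) - 1 + F.L ^ (k + 1) + 2)) ∧
      (∀ (k : ℕ) (ε₁ : ℝ), 0 < ε₁ → ε₁ ≤ C'.a₁ → ∀ V : Site 4 → Fin 4 → (MatA 2)ˣ, V ∈ sfClass 4 F.L (ne3NperOfRecord₁₁ F 0 0) ε₁ 0 →
        ∃ U : Site 4 → Fin 4 → (MatA 2)ˣ, IsMinimiser 4 (sfClass 4 F.L (ne3NperOfRecord₁₁ F 0 0) (C'.B₃ * ε₁)) F.L (ne3NperOfRecord₁₁ F 0 0) (k + 1) V U) := by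
  rintro ⟨C', hB₃, -, hE⟩
  have h := one_le_B₃_of_exists8Min_rank_two (d := 4) (by norm_num) F.hL.2 C' hE
  linarith

/-- **★ FOR EVERY `B < 1` THE SLOT-KEYED TRANSFER IS `¬`(NODE N07's K1-SIDE THEOREM-1 SENTENCE)** (rank two): `Thm1AtTransfer04toSlot F 2 ζ B` holds IFF its antecedent
fails — the chair's A6 species on MY OWN def of file 10; consumers of record key `B` far above `1` (modules 46∕47: `B F := max (C F).B₃ (ε∕b)`; N19′'s rows: `B ≥ 2^78·L^12`),
so no landed theorem is affected. [folklore] -/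
theorem transferSlot_two_iff_not_of_lt_one (F : T4Family) (ζ : ResidZ F 2) {B : ℝ} (hB : B < 1) :
    Thm1AtTransfer04toSlot F 2 ζ B ↔ ¬ ∃ C : B11Thm1.Consts, ∀ i : ZIdx, Thm1At C (varProblemT F 2 i.K i.k (ζ.R i)) :=
  ⟨fun hT hA => not_consequent_transferSlot_two_of_lt_one F hB (hT hA), fun hn hA => absurd hA hn⟩

/-- Hence for every `B < 1` the pair «`B11Leaf (Z11OfRecord F 2 ζ)` ∧ `Thm1AtTransfer04toSlot F 2 ζ B`» of file 10 §2 is UNINHABITED. [folklore] -/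
theorem not_b11Leaf_and_transferSlot_two_of_lt_one (F : T4Family) (ζ : ResidZ F 2) {B : ℝ} (hB : B < 1) :
    ¬ (B11Leaf (Z11OfRecord F 2 ζ) ∧ Thm1AtTransfer04toSlot F 2 ζ B) := by
  rintro ⟨h07, hT⟩
  exact (transferSlot_two_iff_not_of_lt_one F ζ hB).1 hT (exists_thm1At_of_b11Leaf_Z11OfRecord h07)

end TransferTwo

section GenericThree

variable {d : ℕ} {n : Type} [Fintype n] [DecidableEq n]

/-! ## §3 (T9ˢ) below `B₃ = 1` gives the `stub_h7` leaf on ALL data -/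

/-- **★★ INSIDE THE WINDOW CONDITION `B₃(ε + (16∕3)C₀ε²) ≤ ε` THE SLOT KEY DELIVERS THE LEAF (H3ˢᵘᵖ) ON EVERY `dom`.**  Let `L ≥ 2`; `G`, `hGm`, `hG`, `C`, the SLOT KEY
(T9ˢ) `hR` (DISPLAYED) as in file 9; `0 < ε ≤ min(B₃a₁, 1∕28)` in Prop. 2's sharp regime `16C₀ε ≤ 3`, `1024(d+1)(d+4)L²ε ≤ 1`, and `B₃(ε + (16∕3)C₀ε²) ≤ ε` (satisfiable
for small `ε` iff `B₃ < 1`).  THEN `LeafH3sup d L N ε ε (16937ε) dom` for EVERY `dom`: a datum carrying an `ε`-minimiser lies in `sfClass (ε + (16∕3)C₀ε²) 0 ⊆ sfClass (ε∕B₃) 0`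
(§1), so file 9 §2's loose leaf covers it — tight window AP-N16-2 included. [cite: Balaban1985Variational, Thm 1 (9)–(10) p.279] -/
theorem leafH3sup_all_of_reg910Slot_of_window [Nonempty n] {L N : ℕ} (hL : 2 ≤ L)
    {G : (Site d → Fin d → (Matrix n n ℂ)ˣ) → Site d → ℕ → ℝ → ℝ → ℝ → Prop} (hGm : RadiiMono d G)
    (hG : ∀ (U : Site d → Fin d → (Matrix n n ℂ)ˣ) (x : Site d) (K : ℕ) (α₀ α₁ α₂ : ℝ), 2 ≤ K → G U x K α₀ α₁ α₂ →
      ∃ (u : Site d → (Matrix n n ℂ)ˣ) (a : Site d → Fin d → Matrix n n ℂ),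
        (∀ z, u z ∈ unitaryUnits (Matrix n n ℂ)) ∧
        (∀ (y : Site d) (τ : Fin d), l1 (y - x) ≤ 2 → ((gaugeAct u U y τ : (Matrix n n ℂ)ˣ) : Matrix n n ℂ) = exp (a y τ)) ∧
        (∀ (y : Site d) (τ : Fin d), l1 (y - x) ≤ 2 → ‖a y τ‖ ≤ α₀) ∧
        (∀ (y : Site d) (τ i : Fin d), l1 (y - x) ≤ 1 → ‖fd i (fun z => a z τ) y‖ ≤ α₁) ∧
        (∀ (τ i l : Fin d), ‖fd i (fd l (fun z => a z τ)) x‖ ≤ α₂))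
    (C : B11Thm1.Consts)
    (hR : ∀ (k : ℕ) (ε₁ : ℝ), 0 < ε₁ → ε₁ ≤ C.a₁ → ∀ (V U : Site d → Fin d → (Matrix n n ℂ)ˣ), V ∈ sfClass d L N ε₁ 0 →
      IsMinimiser d (sfClass d L N (C.B₃ * ε₁)) L N (k + 1) V U →
        ∀ x : Site d, Regularity (torusVP d L N G (k + 1)) C.B₃ C.B₄ ε₁ U (x, L ^ (k + 1) - 1 + L ^ (k + 1) + 2))
    {ε : ℝ} (hε : 0 < ε) (hεa : ε ≤ C.B₃ * C.a₁) (hε28 : ε ≤ 1 / 28) (hε1 : 16 * C0 d * ε ≤ 3)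
    (hε2 : 1024 * (d + 1) * (d + 4) * (L : ℝ) ^ 2 * ε ≤ 1) (hwin : C.B₃ * (ε + 16 / 3 * C0 d * ε ^ 2) ≤ ε)
    (dom : Set (Site d → Fin d → (Matrix n n ℂ)ˣ)) :
    LeafH3sup d L N ε ε (16937 * ε) dom := by
  have hL1 : 1 ≤ L := by omega
  have hloose := leafH3sup_loose_of_reg910Slot hL1 hGm hG C hR hε hεa hε28 dom
  intro V hV k U hU
  have hVs := datum_mem_sfClass_sharp_of_isMinimiser hL hε.le hε1 hε2 hU
  have h4 : ε + 16 / 3 * C0 d * ε ^ 2 ≤ ε / C.B₃ := by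
    rw [le_div_iff₀ C.B₃_pos]; linarith [mul_comm (ε + 16 / 3 * C0 d * ε ^ 2) C.B₃]
  exact hloose V ⟨hV, sfClass_mono h4 hVs⟩ k U hU

/-- **THE `∃ C′ ε₀` SHAPE ON ALL DATA FOR `B₃ < 1`** (`C′ = 16937`, `ε₀ = min(B₃a₁, 1∕28, 3∕(16C₀), 1∕(1024(d+1)(d+4)L²), 3(1−B₃)∕(16C₀B₃)) > 0`): dag-n16-e's
`stub_h7` SHAPE with no loose cut, from the slot key alone. [cite: Balaban1985Variational, Thm 1 (9)–(10) p.279] -/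
theorem h7Shape_of_reg910Slot_of_B₃_lt_one [Nonempty n] {L N : ℕ} (hL : 2 ≤ L)
    {G : (Site d → Fin d → (Matrix n n ℂ)ˣ) → Site d → ℕ → ℝ → ℝ → ℝ → Prop} (hGm : RadiiMono d G)
    (hG : ∀ (U : Site d → Fin d → (Matrix n n ℂ)ˣ) (x : Site d) (K : ℕ) (α₀ α₁ α₂ : ℝ), 2 ≤ K → G U x K α₀ α₁ α₂ →
      ∃ (u : Site d → (Matrix n n ℂ)ˣ) (a : Site d → Fin d → Matrix n n ℂ),
        (∀ z, u z ∈ unitaryUnits (Matrix n n ℂ)) ∧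
        (∀ (y : Site d) (τ : Fin d), l1 (y - x) ≤ 2 → ((gaugeAct u U y τ : (Matrix n n ℂ)ˣ) : Matrix n n ℂ) = exp (a y τ)) ∧
        (∀ (y : Site d) (τ : Fin d), l1 (y - x) ≤ 2 → ‖a y τ‖ ≤ α₀) ∧
        (∀ (y : Site d) (τ i : Fin d), l1 (y - x) ≤ 1 → ‖fd i (fun z => a z τ) y‖ ≤ α₁) ∧
        (∀ (τ i l : Fin d), ‖fd i (fd l (fun z => a z τ)) x‖ ≤ α₂))
    (C : B11Thm1.Consts) (hB : C.B₃ < 1)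
    (hR : ∀ (k : ℕ) (ε₁ : ℝ), 0 < ε₁ → ε₁ ≤ C.a₁ → ∀ (V U : Site d → Fin d → (Matrix n n ℂ)ˣ), V ∈ sfClass d L N ε₁ 0 →
      IsMinimiser d (sfClass d L N (C.B₃ * ε₁)) L N (k + 1) V U →
        ∀ x : Site d, Regularity (torusVP d L N G (k + 1)) C.B₃ C.B₄ ε₁ U (x, L ^ (k + 1) - 1 + L ^ (k + 1) + 2))
    (dom : Set (Site d → Fin d → (Matrix n n ℂ)ˣ)) :
    ∃ C' ε₀ : ℝ, 0 ≤ C' ∧ 0 < ε₀ ∧ ∀ ε : ℝ, 0 < ε → ε ≤ ε₀ → LeafH3sup d L N ε (C' * ε) (C' * ε) dom := by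
  have hB₃ := C.B₃_pos
  have hC0 := C0_pos d
  have hL0 : (0 : ℝ) < L := by exact_mod_cast (by omega : 0 < L)
  have h1B : 0 < 1 - C.B₃ := by linarith
  refine ⟨16937, min (min (C.B₃ * C.a₁) (1 / 28))
      (min (min (3 / (16 * C0 d)) (1 / (1024 * (d + 1) * (d + 4) * (L : ℝ) ^ 2))) (3 * (1 - C.B₃) / (16 * C0 d * C.B₃))), by norm_num,
    lt_min (lt_min (mul_pos hB₃ C.a₁_pos) (by norm_num)) (lt_min (lt_min (by positivity) (by positivity)) (by positivity)),
    fun ε hε hεle => ?_⟩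
  have ha : ε ≤ C.B₃ * C.a₁ := hεle.trans ((min_le_left _ _).trans (min_le_left _ _))
  have h28 : ε ≤ 1 / 28 := hεle.trans ((min_le_left _ _).trans (min_le_right _ _))
  have h3 : ε ≤ 3 / (16 * C0 d) := hεle.trans ((min_le_right _ _).trans ((min_le_left _ _).trans (min_le_left _ _)))
  have h4 : ε ≤ 1 / (1024 * (d + 1) * (d + 4) * (L : ℝ) ^ 2) :=
    hεle.trans ((min_le_right _ _).trans ((min_le_left _ _).trans (min_le_right _ _)))
  have h5 : ε ≤ 3 * (1 - C.B₃) / (16 * C0 d * C.B₃) := hεle.trans ((min_le_right _ _).trans (min_le_right _ _))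
  have hε1 : 16 * C0 d * ε ≤ 3 := by
    have h : ε * (16 * C0 d) ≤ 3 := by rwa [le_div_iff₀ (by positivity)] at h3
    linarith
  have hε2 : 1024 * (d + 1) * (d + 4) * (L : ℝ) ^ 2 * ε ≤ 1 := by
    have h : ε * (1024 * (d + 1) * (d + 4) * (L : ℝ) ^ 2) ≤ 1 := by rwa [le_div_iff₀ (by positivity)] at h4
    linarith
  have hwin : C.B₃ * (ε + 16 / 3 * C0 d * ε ^ 2) ≤ ε := by
    have h : ε * (16 * C0 d * C.B₃) ≤ 3 * (1 - C.B₃) := by rwa [le_div_iff₀ (by positivity)] at h5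
    nlinarith [hε.le]
  have h := leafH3sup_all_of_reg910Slot_of_window hL hGm hG C hR hε ha h28 hε1 hε2 hwin dom
  exact leafH3sup_mono h (by nlinarith) le_rfl

end GenericThree

section RecordTwo

variable {N : ℕ} [NeZero N]

/-- **★ AT THE RECORD: A SLOT KEY WITH `B₃ < 1` WOULD CLOSE dag-n16-e's ORIGINAL `stub_h7 F` VERBATIM** (`d = 4`, `L = F.L`, `Nper = ne3NperOfRecord₁₁ F 0 0`, the NE3 domain of
record, any radii-monotone shape `G` with the (9)_{β₀=1} interface): the conclusion is the TEXT of `stub_h7 F` (evidence #6), tight window included (model-false by FRONTS).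
Both `hR` and `C.B₃ < 1` are displayed; the statement records what a sub-unit-window producer would be claiming. [cite: Balaban1985Variational, Thm 1 (9)–(10) p.279] -/
theorem h7_at_record_of_reg910Slot_of_B₃_lt_one (F : T4Family)
    {G : (Site 4 → Fin 4 → (MatA N)ˣ) → Site 4 → ℕ → ℝ → ℝ → ℝ → Prop} (hGm : RadiiMono 4 G)
    (hG : ∀ (U : Site 4 → Fin 4 → (MatA N)ˣ) (x : Site 4) (K : ℕ) (α₀ α₁ α₂ : ℝ), 2 ≤ K → G U x K α₀ α₁ α₂ →
      ∃ (u : Site 4 → (MatA N)ˣ) (a : Site 4 → Fin 4 → MatA N),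
        (∀ z, u z ∈ unitaryUnits (MatA N)) ∧
        (∀ (y : Site 4) (τ : Fin 4), l1 (y - x) ≤ 2 → ((gaugeAct u U y τ : (MatA N)ˣ) : MatA N) = exp (a y τ)) ∧
        (∀ (y : Site 4) (τ : Fin 4), l1 (y - x) ≤ 2 → ‖a y τ‖ ≤ α₀) ∧
        (∀ (y : Site 4) (τ i : Fin 4), l1 (y - x) ≤ 1 → ‖fd i (fun z => a z τ) y‖ ≤ α₁) ∧
        (∀ (τ i l : Fin 4), ‖fd i (fd l (fun z => a z τ)) x‖ ≤ α₂))
    (C : B11Thm1.Consts) (hB : C.B₃ < 1)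
    (hR : ∀ (k : ℕ) (ε₁ : ℝ), 0 < ε₁ → ε₁ ≤ C.a₁ → ∀ (V U : Site 4 → Fin 4 → (MatA N)ˣ), V ∈ sfClass 4 F.L (ne3NperOfRecord₁₁ F 0 0) ε₁ 0 →
      IsMinimiser 4 (sfClass 4 F.L (ne3NperOfRecord₁₁ F 0 0) (C.B₃ * ε₁)) F.L (ne3NperOfRecord₁₁ F 0 0) (k + 1) V U →
        ∀ x : Site 4, Regularity (torusVP 4 F.L (ne3NperOfRecord₁₁ F 0 0) G (k + 1)) C.B₃ C.B₄ ε₁ U (x, F.L ^ (k + 1) - 1 + F.L ^ (k + 1) + 2)) :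
    ∃ C' ε₀ : ℝ, 0 ≤ C' ∧ 0 < ε₀ ∧ ∀ ε : ℝ, 0 < ε → ε ≤ ε₀ →
      LeafH3sup 4 F.L (ne3NperOfRecord₁₁ F 0 0) ε (C' * ε) (C' * ε) (ne3DomOfRecord₁₁ F N 0 0) :=
  h7Shape_of_reg910Slot_of_B₃_lt_one F.hL.2 hGm hG C hB hR (ne3DomOfRecord₁₁ F N 0 0)

end RecordTwo

section GenericFour

variable {d : ℕ} {n : Type} [Fintype n] [DecidableEq n]

/-! ## §4 `∃ C` ranges without loss over `B₃ ≥ 1` -/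

/-- **★ `∃ C` RANGES WITHOUT LOSS OVER `B₃ ≥ 1`** (the slot key (T9ˢ) at a fixed shape `G`; `L ≥ 1`): if the key holds at some `C` with `C.B₃ < 1`, it holds at the block
`C′ = (a₀, B₃a₁, 1, B₄, M(·))` (same top radius `B₃a₁ ≤ a₀`) by file 13's antitonicity `reg910Slot_mono_B₃`.  So the producer may take `B₃ ≥ 1` (print does), and a disprover
need only defeat `B₃ ≥ 1` — below it §3 says the key is the full-window leaf anyway. [folklore] -/
theorem exists_consts_iff_one_le {L N : ℕ} (hL : 1 ≤ L) {G : (Site d → Fin d → (Matrix n n ℂ)ˣ) → Site d → ℕ → ℝ → ℝ → ℝ → Prop} :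
    (∃ C : B11Thm1.Consts, ∀ (k : ℕ) (ε₁ : ℝ), 0 < ε₁ → ε₁ ≤ C.a₁ → ∀ (V U : Site d → Fin d → (Matrix n n ℂ)ˣ), V ∈ sfClass d L N ε₁ 0 →
      IsMinimiser d (sfClass d L N (C.B₃ * ε₁)) L N (k + 1) V U →
        ∀ x : Site d, Regularity (torusVP d L N G (k + 1)) C.B₃ C.B₄ ε₁ U (x, L ^ (k + 1) - 1 + L ^ (k + 1) + 2)) ↔
    (∃ C : B11Thm1.Consts, 1 ≤ C.B₃ ∧ ∀ (k : ℕ) (ε₁ : ℝ), 0 < ε₁ → ε₁ ≤ C.a₁ → ∀ (V U : Site d → Fin d → (Matrix n n ℂ)ˣ), V ∈ sfClass d L N ε₁ 0 →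
      IsMinimiser d (sfClass d L N (C.B₃ * ε₁)) L N (k + 1) V U →
        ∀ x : Site d, Regularity (torusVP d L N G (k + 1)) C.B₃ C.B₄ ε₁ U (x, L ^ (k + 1) - 1 + L ^ (k + 1) + 2)) := by
  refine ⟨?_, fun ⟨C, _, hR⟩ => ⟨C, hR⟩⟩
  rintro ⟨C, hR⟩
  by_cases h : 1 ≤ C.B₃
  · exact ⟨C, h, hR⟩
  · have hlt : C.B₃ < 1 := lt_of_not_ge h
    have hB₃ := C.B₃_pos
    have ha₁ := C.a₁_pos
    let C' : B11Thm1.Consts :=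
      { a₀ := C.a₀, a₁ := C.B₃ * C.a₁, B₃ := 1, B₄ := C.B₄, Mfun := C.Mfun,
        a₀_pos := C.a₀_pos, a₁_pos := by positivity, B₃_pos := by norm_num, B₄_pos := C.B₄_pos,
        B₃a₁_le := by nlinarith [C.B₃a₁_le], Mfun_pos := C.Mfun_pos }
    refine ⟨C', le_rfl, reg910Slot_mono_B₃ hL C C' hlt.le ?_ hR⟩
    show 1 * (C.B₃ * C.a₁) ≤ C.B₃ * C.a₁
    linarith

/-- **THE DISCHARGE-TESTS' STUB SHAPE, NORMALISED AT THE UNIT THRESHOLD** (`∃ G C, RadiiMono d G ∧ interface G ∧ (T9ˢ)(G, C)` = the text of dag-n16-e's v6 ∕ dag-n16-w2's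
v6L `stub_reg910Slot`, read generically in `(d, n, L, N)`, the interface abstracted as `IF G`; `L ≥ 1`): any inhabitant yields one with `1 ≤ C.B₃`.  Nothing of it is
asserted here. [folklore] -/
theorem exists_shape_one_le_of_exists_shape {L N : ℕ} (hL : 1 ≤ L)
    {IF : ((Site d → Fin d → (Matrix n n ℂ)ˣ) → Site d → ℕ → ℝ → ℝ → ℝ → Prop) → Prop}
    (h : ∃ (G : (Site d → Fin d → (Matrix n n ℂ)ˣ) → Site d → ℕ → ℝ → ℝ → ℝ → Prop) (C : B11Thm1.Consts), RadiiMono d G ∧ IF G ∧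
      (∀ (k : ℕ) (ε₁ : ℝ), 0 < ε₁ → ε₁ ≤ C.a₁ → ∀ (V U : Site d → Fin d → (Matrix n n ℂ)ˣ), V ∈ sfClass d L N ε₁ 0 →
        IsMinimiser d (sfClass d L N (C.B₃ * ε₁)) L N (k + 1) V U →
          ∀ x : Site d, Regularity (torusVP d L N G (k + 1)) C.B₃ C.B₄ ε₁ U (x, L ^ (k + 1) - 1 + L ^ (k + 1) + 2))) :
    ∃ (G : (Site d → Fin d → (Matrix n n ℂ)ˣ) → Site d → ℕ → ℝ → ℝ → ℝ → Prop) (C : B11Thm1.Consts), RadiiMono d G ∧ IF G ∧ 1 ≤ C.B₃ ∧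
      (∀ (k : ℕ) (ε₁ : ℝ), 0 < ε₁ → ε₁ ≤ C.a₁ → ∀ (V U : Site d → Fin d → (Matrix n n ℂ)ˣ), V ∈ sfClass d L N ε₁ 0 →
        IsMinimiser d (sfClass d L N (C.B₃ * ε₁)) L N (k + 1) V U →
          ∀ x : Site d, Regularity (torusVP d L N G (k + 1)) C.B₃ C.B₄ ε₁ U (x, L ^ (k + 1) - 1 + L ^ (k + 1) + 2)) := by
  obtain ⟨G, C, hGm, hG, hR⟩ := h
  obtain ⟨C', hq, hR'⟩ := (exists_consts_iff_one_le (G := G) hL).1 ⟨C, hR⟩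
  exact ⟨G, C', hGm, hG, hq, hR'⟩

end GenericFour

end

end Summit.QuantumFields.YangMills.BalabanUVNodes.N16SlotKeyUnit
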